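/-
Origin: expansion seat `planner-pub-hodgecm-mc-sanity-1-g14-0`, handover #SAN30A 2026-08-21T01:28Z md5 2a22bf80b9bd (SAN-30A; NEW additive KERNEL census leaf, 109 l., 3 theorems ∕ 0 Prop-defs in ns HodgeCM.Model.Sanity — the degenerate census of the E term of record «A» `perL_picardCM_r21AEOGIA` (RUN 68, #EA66): `perL_r21AEOGIA_degS_scope` («A» over `S := degS`, `W := zeroSK ∘ W` closes PerL modulo its own `C` = SAN-30's `CdegSOGS` at the kernel `hA`, unwrapped; the eight Prop rows discharged at every context, guards ignored), `isEmpty_CdegSOGS_orientBitι_hA` (that `C` is EMPTY), `CdegSOGS_hA_elim` (from such a `C` anything follows — no degenerate datum closes «A»); imports Model.E2InstanceOGR21AEPIA + Sanity.DegenerateClosureOGScope only; no rowdep in RUN 69; drop-alone; rc 0 ∕ 0 warn ∕ 0 proof holes ∕ closures ⊆ trio 3 ∕ 3; NAME LIST: HodgeCM.Model.Sanity.perL_r21AEOGIA_degS_scope · HodgeCM.Model.Sanity.isEmpty_CdegSOGS_orientBitι_hA · HodgeCM.Model.Sanity.CdegSOGS_hA_elim) (`HOME/mc/pub-hodgecm-mc-sanity-1-g14/stage69/HodgeCM/Model/Sanity/DegenerateClosureOGIA.lean`,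 md5 2a22bf80b9bd, 109 lines);
landed by the gen-29 packager (p-g29) in gate run 69 as `HodgeCM/Model/Sanity/DegenerateClosureOGIA.lean` (verbatim).
-/
/-
HodgeCM / MODEL-CONSTRUCTION sub-cell (pub-hodgecm), SANITY lane (unit `pub-hodgecm-mc-sanity-1-g14`, node SAN-30A).
NEW additive KERNEL leaf `HodgeCM/Model/Sanity/DegenerateClosureOGIA.lean`; imports the E TERM OF RECORD from `RUN 68 (` on,
`HodgeCM.Model.E2InstanceOGR21AEPIA` (glue-1 #EA66, RUN 68; lead 1-g81 WORD (α-A) STATUS l.14760 «E BECOMES «A» AT `RUN 68 (`») and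
SAN-30 `HodgeCM.Model.Sanity.DegenerateClosureOGScope` (RUN 57); nothing imports it; 0 records, 0 `def … : Prop`, 0 hypotheses records,
0 proof holes; MODEL-N ±0; E bytes untouched.
-/
import Summits.HodgeConjecture.HodgeCM.Model.E2InstanceOGR21AEPIA
import Summits.HodgeConjecture.HodgeCM.Model.Sanity.DegenerateClosureOGScope

/-!
# SAN-30A — the degenerate census of the E TERM OF RECORD «A» (RUN 68): E₅₆ with its cited row `hA` DISCHARGED IN THE KERNEL

The E term of record from `RUN 68 (` on, «A» `Model.perL_picardCM_r21AEOGIA` (glue-1 #EA66), is the RUN-56 E term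
`Model.perL_picardCM_r21AEOGI` applied at
`hA := Literature.NumberTheory.Transcendental.arapura2012_cor_15_4_6_holds` (packet hA, RUN 66): 13 binder groups
`W S μ hR hΘ C hT hpd hk gen12 real34 hyp12 hyp34`, every `S`/`W`-parametric row byte-identical to E's with `hA` so instantiated.
Hence its census over the degenerate data `S := degS`, `W := zeroSK ∘ W` is SAN-30's, read at the kernel `hA`:

* `perL_r21AEOGIA_degS_scope (C : CdegSOGS … arapura2012_cor_15_4_6_holds W μ) : PerL` — «A» over the degenerate data
  closes PerL modulo EXACTLY its own group `C` (SAN-30's scope-guarded oriented data binder at the kernel `hA`), handed over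
  unwrapped; the eight Prop rows `hΘ hT hpd hk gen12 real34 hyp12 hyp34` discharged at every context, guards ignored, by the
  SAN-22/25/27/30 discharges verbatim;
* `isEmpty_CdegSOGS_orientBitι_hA` — that `C` is EMPTY (SAN-30 `isEmpty_CdegSOGS_orientBitι` at the kernel `hA`);
* `CdegSOGS_hA_elim` — so, exactly as for E, NO degenerate datum closes «A»: from such a `C` anything follows, vacuously.

READING (census): striking the cited row `hA` by its kernel proof changes no `S`/`W`-parametric byte of E; the gatekeeper `C` against a
degenerate closing is byte-for-byte E₅₆'s (SAN-27/28/30), read at the kernel `hA`, and uninhabited over `degS` — «A» is closed by NO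
degenerate data.  KERNEL ONLY: 3 theorems; nothing here is a claim of the manuscripts under adjudication.
-/

set_option autoImplicit false

noncomputable section

namespace HodgeCM
namespace Model
namespace Sanity

open HodgeCM.Universe (SideData ThetaModel AdelicThetaCore AdelicTorusCore)
open HodgeCM.PerL34 HodgeCM.PerL34.ArchC
open Literature.AlgebraicGeometry.HodgeTheory Literature.NumberTheory.Automorphic.PicardCM
open Literature.NumberTheory.Transcendental (Arapura2012_Cor_15_4_6 arapura2012_cor_15_4_6_holds)
open Literature.AlgebraicGeometry.ShimuraVarieties
open Literature.AlgebraicGeometry.Motives (CMType)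
open HodgeCM.Model.ThetaSpace
open HodgeCM.Model.SupplyResidual

variable (hHD : exists_isReal_hodgeModel) (hI : hodgePQ_independent_of_hodgeModel)
  (h₁ : BallQuotientUniformised)

/-- **The E term of record «A» over the degenerate data closes PerL modulo EXACTLY its own (scope-guarded) group `C`** at the kernel
`hA`, handed over unwrapped — the other eight Prop rows discharged at every context, guards ignored (SAN-22/25/27/30 verbatim). -/
theorem perL_r21AEOGIA_degS_scope (h₃' : CMAbelianVarietyEigenbasisRealised)
    (W : ∀ {L : CMField} {ι₁ : L →+* ℂ} (V : HermSpace3 L ι₁) (c : SeesawCtx L), WmInput V c.D)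
    (μ : ∀ {L : CMField}, SeesawCtx L → Fin 4 → NumberField.InfinitePlace L → ℤ)
    (hR : DeligneMilne1982_Thm_6_20_full)
    (C : CdegSOGS hHD hI h₁ (cmAbelianVarietyRealised_of_eigenbasis hHD hI h₃') orientBitι arapura2012_cor_15_4_6_holds W μ) :
    (picardCMUniverse hHD hI h₁ (cmAbelianVarietyRealised_of_eigenbasis hHD hI h₃')).PerL := by
  refine perL_picardCM_r21AEOGIA hHD hI h₁ h₃' (fun V c => (W V c).zeroSK) degS μ hR
    ?_ C ?_ ?_ ?_ ?_ ?_ ?_ ?_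
  · -- `hΘ` at the bit of record, guards ignored — SAN-22
    intro L ι₁ V c _ _ _ i
    exact hTheta_degS hHD hI h₁ _ (orientBitι L ι₁) (embOf hHD hI h₁ _) (coverOf hHD hI h₁ _ arapura2012_cor_15_4_6_holds)
      (wmOfInput fun V c => (W V c).zeroSK) (d12Of μ) (d34Of μ) V c i
  · -- `hT`
    intro L ι₁ V c k N
    exact isThetaArchContinuous_degS V c k N
  · -- `hpd` — vacuous over the empty `C`-fibre
    intro L ι₁ V c hV hc h6 hcan k hk N hN
    exact ((isEmpty_C_fibre_degS hHD hI h₁ _ V c hV).false (C V c hV hc h6 hcan)).elim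
  · -- `hk` (along form)
    intro L ι₁ V c hV hc h6 hcan k hk N hN p
    exact ((isEmpty_C_fibre_degS hHD hI h₁ _ V c hV).false (C V c hV hc h6 hcan)).elim
  · -- `gen12`, scope read through its rank component
    intro L ι₁ V c hc h6 _
    exact gen12_degS' hHD hI h₁ _ (orientBitι L ι₁) (embOf hHD hI h₁ _) (coverOf hHD hI h₁ _ arapura2012_cor_15_4_6_holds)
      (fun V c => (W V c).zeroSK) μ V c hc h6.1
  · -- `real34`, guards ignored
    intro L ι₁ V c _ _ _
    exact real34_zeroSK (embOf hHD hI h₁ _) (coverOf hHD hI h₁ _ arapura2012_cor_15_4_6_holds) W _ (orientBitι L ι₁)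
      (d12Of μ) (d34Of μ) V c
  · -- `hyp12`, guards ignored
    intro L ι₁ V c _ _ _
    exact hyp12_zeroSK (embOf hHD hI h₁ _) (coverOf hHD hI h₁ _ arapura2012_cor_15_4_6_holds) W _ (orientBitι L ι₁) _ _ _ V c
  · -- `hyp34`, guards ignored
    intro L ι₁ V c _ _ _
    exact hyp34_zeroSK (embOf hHD hI h₁ _) (coverOf hHD hI h₁ _ arapura2012_cor_15_4_6_holds) W _ (orientBitι L ι₁) _ _ _ V c

/-- **That `C` is EMPTY** — SAN-30 `isEmpty_CdegSOGS_orientBitι` read at the kernel `hA`. -/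
theorem isEmpty_CdegSOGS_orientBitι_hA (h₃ : CMAbelianVarietyRealised)
    (W : ∀ {L : CMField} {ι₁ : L →+* ℂ} (V : HermSpace3 L ι₁) (c : SeesawCtx L), WmInput V c.D)
    (μ : ∀ {L : CMField}, SeesawCtx L → Fin 4 → NumberField.InfinitePlace L → ℤ) :
    IsEmpty (CdegSOGS hHD hI h₁ h₃ orientBitι arapura2012_cor_15_4_6_holds W μ) :=
  isEmpty_CdegSOGS_orientBitι hHD hI h₁ h₃ arapura2012_cor_15_4_6_holds W μ

/-- **No degenerate datum closes «A»**: from a closing datum `C` over the degenerate data ANY proposition follows,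
vacuously — the hand-over premise of `perL_r21AEOGIA_degS_scope` is never met. -/
theorem CdegSOGS_hA_elim (h₃ : CMAbelianVarietyRealised)
    (W : ∀ {L : CMField} {ι₁ : L →+* ℂ} (V : HermSpace3 L ι₁) (c : SeesawCtx L), WmInput V c.D)
    (μ : ∀ {L : CMField}, SeesawCtx L → Fin 4 → NumberField.InfinitePlace L → ℤ) (P : Prop)
    (C : CdegSOGS hHD hI h₁ h₃ orientBitι arapura2012_cor_15_4_6_holds W μ) : P :=
  ((isEmpty_CdegSOGS_orientBitι_hA hHD hI h₁ h₃ W μ).false C).elim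

end Sanity
end Model
end HodgeCM

end
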